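import Literature.NumberTheory.EllipticCurves.Kato2004.IwasawaCohomologyUniqueProofs
import Literature.NumberTheory.EllipticCurves.CyclotomicLayerTatePairing
import Literature.NumberTheory.EllipticCurves.CyclotomicZpExtensionLocalGeneratorProofs
import Literature.NumberTheory.EllipticCurves.ZpExtensionEisensteinOrdinaryFiltration
import Literature.NumberTheory.GaloisRepresentations.ContinuousCorestrictionTransportOnto
import HarnessLib

/-!
# Kato 2004 (Astérisque 295) §12.2 (12.2.3) and §17.13: the LOCAL Iwasawa cohomology
# `𝐇¹_loc(T) = lim←_n H¹(ℚ_{n,v}, T)` of a `p`-adic representation `T` of `Gal(ℚ̄_v/ℚ_v)` along the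
# cyclotomic tower, as a PINNED `Λ`-module interface (`LocalIwasawaH1Data`) which is PROVED to exist and
# to be unique; the localisation `loc_v : 𝐇¹_Γ(T_pW) → 𝐇¹_loc(T_pW)` from Kato's global `𝐇¹`
# (`IwasawaH1Data.loc`); and the ordinary part `F⁺_v T_pE = T_p(E₁) ≤ T_pE` (`T' = T ∩ V'` of Lemma 17.9/(17.13.3))

Topic `NumberTheory/EllipticCurves`, sub-directory `Kato2004` (namespace = path).  Definition seat
`bsd-2adic-defn-c1` (cell `pub/bsd-2adic`, crux `OrdLambdaHalfAtTwo` = item 19556 of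
`Summits/BirchSwinnertonDyer`, line `kato_determinant_greenberg_two` v3.2; RECUT memo d2d9bf4ff133 §1
"carriers C1/C2"): the GENUINE local carrier on which the line's pinned Kato–Greenberg datum (v4:
`Hl := H¹_Iw(ℚ_{2,∞}, T₂E)`, `locW, locA :=` the localisations, `Hf :=` the `F⁺`-part) can be stated
WITHOUT positing an unpinned interface (memo ADD-1 (i): over a free local interface the `∀`-stubs are
junk-refutable).  HONEST FRAMING: definitions with bodies, one hypothesis structure whose EXISTENCE and
UNIQUENESS are theorems of this file, proved API; NO named fact, no `instance`, no notation, no `sorry`;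
nothing here is specific to `p = 2` or to any summit; BSD is not proved by any of this.

## The printed statements (K. Kato, Astérisque 295 (2004); `[p. N]` printed page; store
`paper:doi-10-24033-ast-639`, PDF page `N − 115`)

* **§12.2 [p. 220]** "On the other hand, for a finitely generated `ℤ_p`-module `T` endowed with a
  continuous action of `Gal(ℚ̄_p/ℚ_p)`, let `𝐇^q_loc(T) = lim←_n H^q(ℚ_p(ζ_{p^n}), T)`.  Then the following
  are known: **(12.2.3)** `𝐇^q_loc(T) = 0` if `q ≠ 1, 2`, `𝐇¹_loc(T)` and `𝐇²_loc(T)` are finitely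
  generated `ℤ_p[[G_∞]]`-modules, and `dim(𝐇¹_loc(T)_𝔮) = rank_{ℤ_p}(T)`, `dim(𝐇²_loc(T)_𝔮) = 0` for any
  prime ideal `𝔮` of `ℤ_p[[G_∞]]` of height `0`.  The structure of `𝐇²_loc(T)` is well understood: By local
  Tate duality `𝐇²_loc(T) ≅ Hom(H⁰(ℚ_p(ζ_{p^∞}), Hom(T, ℚ/ℤ)), ℚ/ℤ)(−1)`."  (Also §12.2: "the inverse limit
  is taken with respect to trace maps".)
* **§17.13 [p. 279]** "(17.13.1) `0 → 𝐇¹(T(k))/(…) → 𝐇¹_loc(T(k))/(lim← H¹_f(ℚ_p(ζ_{p^n}),T(r))(k−r)) →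
  𝔛(T*(1−k)) → 𝐇²(T(k)) → 𝐇²_loc(T(k))` …  (17.13.3) `lim←_n H¹_f(ℚ_p(ζ_{p^n}), T(r))(k−r) ≅ 𝐇¹_loc(T'(k))`
  where `T' = T ∩ V'_{F_λ}(f*)`" (`T, T', T''` "as in 17.2"; Lemma 17.9 [p. 275]: "the image of
  `lim← H¹_f(ℚ_p(ζ_{p^n}), T(r))` in `𝐇¹_loc(T(r))` coincides with the image of `𝐇¹_loc(T'(r))`"); the first arrow
  is the LOCALISATION `𝐇¹ → 𝐇¹_loc` (inverse limit of the restrictions `H¹(ℤ[ζ_{p^n},1/p], T) →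
  H¹(ℚ_p(ζ_{p^n}), T)`), typed here BEFORE the quotient by `𝐇¹_loc(T')`.
* B. Perrin-Riou, Invent. Math. 115 (1994) (Kato's [Pe2], the source of his Thm. 16.4 `𝔏_η`): Iwasawa
  theory of a `p`-adic representation of a LOCAL field along the cyclotomic tower — the inverse limits
  of the `H¹(ℚ_p(μ_{p^n}), T)` under corestriction, `Λ`-modules through the Galois action on the tower,
  are the objects of her `Λ`-adic exponential map (there `p` is odd). [PerrinRiou1994Invent]

## READING (the `Δ`-trivial local tower; same convention as the global pin `Kato2004.IwasawaH1Data`)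

The tree's `Λ = IwasawaAlgebra p = ℤ_p⟦X⟧` is the algebra of the `ℤ_p`-extension `κ : ZpExtension ℚ p`
(layers `ℚ_n`, `κ.layerSubgroup n = Gal(ℚ̄/ℚ_n)`), not Kato's two-dimensional `ℤ_p[[G_∞]]`,
`G_∞ = Gal(ℚ(ζ_{p^∞})/ℚ) = Δ × Γ`; exactly as `IwasawaCohomology.lean` types the `Δ`-trivial component
`𝐇¹_Γ(T) = lim←_n H¹(ℤ_n[1/p], T)` of Kato's `𝐇¹(T)`, this file types the LOCAL tower at a finite place `v`
of `ℚ`: `ℚ_{n,v} := ℚ_n · ℚ_v ⊂ ℚ̄_v`, the completion of `ℚ_n` at the place above `v` singled out by the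
tree's chosen embedding `ℚ̄ → ℚ̄_v` (`closureEmb`), with absolute Galois group
`U_n = Gal(ℚ̄_v/ℚ_{n,v}) = res_v⁻¹(Gal(ℚ̄/ℚ_n)) ≤ Γ_{ℚ_v}` — the tree's
`CyclotomicLayer.layerGroup κ v n` (= `Kobayashi2003.localLayerSubgroupOfEmb κ (closureEmb ℚ_v) n`,
Kobayashi's `F_{n,p}`), open, normal, of index dividing `pⁿ`, REUSED (not redefined) — and
`𝐇¹_loc(T) := lim←_n H¹(U_n, T)` along the local corestrictions.  For `v = p` and `κ` cyclotomic,
`ℚ_{n,p}` is the `n`-th layer of the cyclotomic `ℤ_p`-extension of `ℚ_p` and `ℚ_p(ζ_{p^{n+1}}) =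
ℚ_{n,p}(μ_p)` (`p` odd; `ℚ_2(ζ_{2^{n+2}}) = ℚ_{n,2}(i)`), so this is the `Δ`-trivial part of Kato's
`𝐇¹_loc(T)` in the same sense (restriction–corestriction with `Δ`) as in the module docstring of
`IwasawaCohomology.lean`, clause by clause; for `v ∤ p` it is the Iwasawa cohomology over the unramified
`ℤ_p`-tower of `ℚ_v` cut out by `κ`.  No statement of (12.2.3) is vendored here (see "NOT here").

## What is here (all definitions have bodies; all theorems are proved)

§1 `localLayerCores κ v T n` (the local trace map `Cor : H¹(ℚ_{n+1,v}, T) → H¹(ℚ_{n,v}, T)`, the tree's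
`coresLe`), `localLayerConj` (the action of `Γ_{ℚ_v}`), `localLayerCores_localLayerConj` (they commute),
`IsLocalNormCompatible` / `localNormCompatible` (the inverse limit written inside `∏_n H¹(ℚ_{n,v}, T)`),
for ANY topological coefficient ring `A` and `T : GaloisRep (v.adicCompletion ℚ) A M`.
§2 **`LocalIwasawaH1Data κ v T γ`** (`T` with `ℤ_p`-coefficients, `γ ∈ Γ_{ℚ_v}`): the hypothesis
structure `H`, `proj n : H →+ H¹(ℚ_{n,v}, T)`, `cores_proj`, `proj_injective`, `proj_surjective`,
`proj_T_smul` (`X` acts as `conj_γ − 1`), `proj_C_smul` — the exact local analogue of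
`Kato2004.IwasawaH1Data` (no integrality condition: local fields); API `toFamily`, `ext_of_proj`,
`exists_unique_lift`; RIGIDITY `proj_coe_smul`, `proj_omega_smul` (`ω_n = (X+1)^{pⁿ} − 1` kills the `n`-th
layer, since `γ^{pⁿ} ∈ U_n` for EVERY `γ`), `proj_smul` (the `Λ`-action of any datum is levelwise through
`Λ/(ω_n) ≅ ℤ_p[X]/(ω_n)`), and UNIQUENESS `exists_linearEquiv` / `eq_of_proj_comp_eq`.
§3 **EXISTENCE `nonempty_localIwasawaH1Data`**: the datum on the norm-compatible families, `Λ` acting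
on the `n`-th level by Weierstrass division by `ω_n` (`IwasawaH1Exists.exists_ringHom_of_pow_eq_one`),
verbatim the construction of `IwasawaCohomologyExistsProofs.lean` — for every `κ`, `v`, `T`, `γ`.
§4 The localisation: `layerLoc T κ v n : H¹(ℚ_n, T) → H¹(ℚ_{n,v}, T)` (pull-back along
`res_n : U_n → Γ_n`), `layerLoc_conjMap` (equivariance), the abstract transport lemma
`map_coresLe_eq_coresLe_map` (relative corestrictions commute with pull-back along homomorphisms meeting
every coset — NSW (1.5.6), single double coset; stated for abstract groups so that its instances are
kernel-cheap) and its instance `layerLoc_layerCores` (`loc` commutes with the trace maps whenever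
`κ ∘ res_v` is onto, `exists_layerRes_inv_mul_mem`; onto holds at `v ∣ p` for the cyclotomic `κ`,
`surjective_comp_resGalOfEmb_of_isCyclotomic`, from the tree's
`ZpExtension.IsCyclotomic.exists_apply_resGalOfEmb_adicCompletion_eq`), and **`IwasawaH1Data.loc I J
hsurj hγ hγᵥ : I.H →ₗ[Λ] J.H`** for `I : IwasawaH1Data W p κ γ`, `J : LocalIwasawaH1Data κ v
((tateRep W p).toLocal v) γᵥ`, `γ`, `res γᵥ` normalised topological generators (such `γᵥ` exist:
`ZpExtension.IsCyclotomic.exists_isTopGenerator_resGalOfEmb_adicCompletion`): `Λ`-linear (levelwise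
actions + `layerLoc_comp_conj_sub_one`), characterised by `proj_loc : J.proj n (loc x) = loc_n (I.proj n x)`,
unique (`loc_unique`), and computing the image of a lifted norm-compatible family (`proj_loc_of_proj_eq`:
Kato's `𝐳 = (z_{p^n})_n ↦ (loc_n z_{p^n})_n`).
§5 **`tateModuleFilAt W p v ≤ W.tateModule p`**: `F⁺_v T_pE = T_p(E₁(K̄_v))`, the elements of the Tate
module all of whose components lie in the kernel of reduction `E₁(K̄_v)`
(`WeierstrassCurve.localKernelOfReduction`; finite levels = the tree's `WeierstrassCurve.torsionFilAt`,
`mem_tateModuleFilAt_iff_torsionFilAt`), a `ℤ_p`-submodule stable under `Γ_{K_v}`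
(`smul_mem_tateModuleFilAt`, `tateRep_toLocal_mem_tateModuleFilAt`) — for any number field `K` and place
`v`; at good ordinary `v ∣ p` this is Kato's `T'` (Greenberg's `F⁺ = 𝓕(𝔪̄)`, Howard's `Fil_v T`).

## Design notes

* The `Λ`-variable acts through a LOCAL element `γᵥ ∈ Γ_{ℚ_v}` (Kobayashi's/Sprung's "local generator",
  `CyclotomicZpExtensionLocalGeneratorProofs`); compatibility with a global datum pinned by `γ ∈ Γ_ℚ`
  needs only `κ(res γᵥ) = κ(γ)` (`inv_mul_mem_layerSubgroup_of_isTopGenerator`: then `conj_γ = conj_{res γᵥ}`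
  on every `H¹(ℚ_n, T)`).  The structure facts `ContinuousSMul ℤ_[p] (W.tateModule p)` stay instance
  BINDERS as in `EulerSystemValues.tateRep` (dischargeable by `TateModule.continuousSMul_padicInt`).
* Everything in §§1–3 is generic in the local representation `T` (so the same carrier serves `T_pW`,
  its twists, and — once typed as `GaloisRep`s — the sub/quotient `F^±` pieces of §5); §4 is generic in
  `T : GaloisRep ℚ A M` up to `loc`, which is stated for `tateRep W p` because `IwasawaH1Data` is.
* Kernel cost: unfolding `toSubgroupOf`/`map_oneCocycleClass` at concrete Galois representations is
  prohibitively expensive for the kernel; all cocycle computations are therefore done in the abstract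
  lemma `map_coresLe_eq_coresLe_map` and instantiated (`layerCores_eq_coresLe`, `localLayerCores_eq_coresLe`
  absorb the `Fintype` instance choices).

## What is NOT here (scope; no fact is vendored)

(12.2.3) itself (finite generation, `Λ`-rank `= rank_{ℤ_p} T`, `𝐇²_loc`), the torsion of `𝐇¹_loc`
(`= T^{G_{ℚ_{v,∞}}}`-type statements), Perrin-Riou's exponential / Coleman maps (RECUT C3), the
`F⁺`/`F⁻` sub- and quotient REPRESENTATIONS as `GaloisRep`s and the rank-one / unramified-quotient
properties of `F⁺_v T_pE` at good ordinary `v` (RECUT C2's theorems; the tree has the newform-lattice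
version `GreenbergSelmerNewform.OrdinaryFiltration`), `𝐇²_loc`, semi-local versions at `v ∤ p` with
several primes above `v`, any `p = 2`-specific statement.  Consumers needing (12.2.3) at `p = 2` must
vendor it as a named fact with the READING above (the `Δ`-argument of `IwasawaCohomology.lean` (β₂)).

## References

* K. Kato, *p-adic Hodge theory and values of zeta functions of modular forms*, Astérisque 295 (2004):
  §12.2 with (12.2.3) (p. 220), §13.8 (p. 228), 17.2 and Lemma 17.9 (pp. 272–275), §17.13
  (17.13.1)–(17.13.3) (p. 279) — read 2026-08-28 from the store text `paper:doi-10-24033-ast-639`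
  (pp. 105, 157–164). [Kato2004Asterisque]
* B. Perrin-Riou, *Théorie d'Iwasawa des représentations p-adiques sur un corps local*, Invent. Math.
  115 (1994) (Kato's [Pe2]). [PerrinRiou1994Invent]
* J. Neukirch, A. Schmidt, K. Wingberg, *Cohomology of Number Fields* (2008), I §5 Prop. 1.5.4,
  (1.5.6)–(1.5.7). [NeukirchSchmidtWingberg2008]
* S. Lang, *Cyclotomic Fields I and II*, GTM 121 (1990), Ch. 5 §1 Thm. 1.1. [Lang1990]
* L. C. Washington, *Introduction to Cyclotomic Fields* (1997), §13.1–13.2, Prop. 13.2. [Washington1997]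
* J.-P. Serre, *Local Fields* (1979), VII §5. [SerreLocalFields1979]
* S. Kobayashi, Invent. Math. 152 (2003), Def. 1.1, §2. [Kobayashi2003]
* R. Greenberg, LNM 1716 (1999), §2; B. Howard, Compositio 140 (2004), §3.1 (`Fil_v T`).
  [GreenbergLNM1716] [Howard2004HeegnerKolyvagin]
* Tree: `Kato2004/IwasawaCohomology.lean` (the global pin), `…ExistsProofs` / `…UniqueProofs` (the
  pattern of §§2–3), `CyclotomicLayerTatePairing.lean` (`layerGroup`), `Kobayashi2003/SignedSelmer.lean`,
  `CyclotomicZpExtensionLocalGeneratorProofs.lean`, `ContinuousCorestriction*.lean`,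
  `ZpExtensionEisensteinOrdinaryFiltration.lean` (`torsionFilAt`), `DivisibilityInputs.lean` (the consumer
  shape `loc : I.H →ₗ[Λ] P`).
-/

noncomputable section

open scoped NumberField
open Field IsDedekindDomain CategoryTheory Polynomial
open Literature.NumberTheory.GaloisRepresentations
open Literature.NumberTheory.EllipticCurves Literature.NumberTheory.EllipticCurves.Kato2004
open Literature.NumberTheory.EllipticCurves.Kato2004.EulerSystemValues
open Literature.NumberTheory.EllipticCurves.CyclotomicLayer (layerGroup isOpen_layerGroup
  normal_layerGroup)

namespace Literature.NumberTheory.EllipticCurves.Kato2004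

/-! ## §1 The local layers `U_n = Gal(ℚ̄_v/ℚ_{n,v})`, their trace maps and the action of `Γ_{ℚ_v}` -/

section LocalLayers

variable {p : ℕ} [Fact p.Prime] (κ : ZpExtension ℚ p) (v : HeightOneSpectrum (𝓞 ℚ))
  {A : Type} [CommRing A] [TopologicalSpace A]
  {M : Type} [AddCommGroup M] [Module A M] [TopologicalSpace M] [IsTopologicalAddGroup M]
  [ContinuousSMul A M] (T : GaloisRep (v.adicCompletion ℚ) A M)

/-- The local layer groups decrease: `U_{n'} ≤ U_n` for `n ≤ n'` (`ℚ_{n,v} ⊆ ℚ_{n',v}`).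
[cite: Kato2004Asterisque, §12.2 (p. 220)] -/
theorem layerGroup_antitone : Antitone (layerGroup κ v) :=
  Kobayashi2003.localLayerSubgroupOfEmb_antitone κ _

/-- `g^{pⁿ} ∈ U_n` for EVERY `g ∈ Γ_{ℚ_v}`: `κ(res g^{pⁿ}) = pⁿ·κ(res g) ∈ pⁿℤ_p` (the `n`-th layer of a
`ℤ_p`-extension is cut out by `pⁿℤ_p`). [cite: Washington1997, §13.1] -/
theorem pow_mem_layerGroup (g : absoluteGaloisGroup (v.adicCompletion ℚ)) (n : ℕ) :
    g ^ p ^ n ∈ layerGroup κ v n := by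
  rw [Kobayashi2003.mem_localLayerSubgroupOfEmb_iff, map_pow, map_pow]
  exact ⟨(κ (resGalOfEmb (closureEmb (K := ℚ) (v.adicCompletion ℚ)) g)).toAdd, by
    rw [toAdd_pow, nsmul_eq_mul, Nat.cast_pow]⟩

/-- A `Fintype` structure on `U_n ⧸ U_{n'}` (finite: `Kobayashi2003.finite_localLayerQuotient`), the
instance binder of `coresLe` / `coresLe_conjMap` for the local layers; a definition so that every
construction below carries the same instance term. [cite: Kato2004Asterisque, §12.2 (p. 220)] -/
@[reducible] def localLayerFintypeQuot (n n' : ℕ) :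
    Fintype (layerGroup κ v n ⧸ (layerGroup κ v n').subgroupOf (layerGroup κ v n)) :=
  Fintype.ofFinite _

/-- **The local trace map** `Cor : H¹(ℚ_{n+1,v}, T) → H¹(ℚ_{n,v}, T)` between consecutive local layers
(`U_{n+1} ≤ U_n`, open of finite index in `Γ_{ℚ_v}`), the tree's relative corestriction `coresLe` —
the transition maps of Kato's `𝐇^q_loc(T) = lim←_n H^q(ℚ_p(ζ_{p^n}), T)` ("the inverse limit is taken
with respect to trace maps", §12.2), exactly as `Kato2004.layerCores` packages the global ones.
[cite: Kato2004Asterisque, §12.2 (p. 220)] -/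
def localLayerCores (n : ℕ) : H1 T (layerGroup κ v (n + 1)) →ₗ[A] H1 T (layerGroup κ v n) :=
  haveI := localLayerFintypeQuot κ v n (n + 1)
  coresLe T.toTopRep (layerGroup_antitone κ v (Nat.le_succ n)) (isOpen_layerGroup κ v (n + 1))

/-- **The action of `g ∈ Γ_{ℚ_v}` on `H¹(ℚ_{n,v}, T)`** (`conjMap` of `ContinuousCorestriction.lean`
with the normality of `U_n ⊴ Γ_{ℚ_v}` supplied): the `Gal(ℚ_{n,v}/ℚ_v)`-module structure through which
`Λ` acts. [cite: SerreLocalFields1979, VII §5] -/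
def localLayerConj (n : ℕ) (g : absoluteGaloisGroup (v.adicCompletion ℚ)) :
    H1 T (layerGroup κ v n) ⟶ H1 T (layerGroup κ v n) :=
  haveI := normal_layerGroup κ v n
  conjMap T.toTopRep (layerGroup κ v n) g 1

/-- Unfolding `localLayerConj`. [cite: SerreLocalFields1979, VII §5] -/
theorem localLayerConj_eq (n : ℕ) (g : absoluteGaloisGroup (v.adicCompletion ℚ)) :
    localLayerConj κ v T n g =
      (haveI := normal_layerGroup κ v n; conjMap T.toTopRep (layerGroup κ v n) g 1) :=
  rfl

/-- The operator `g·` on `H¹(ℚ_{n,v}, T)` satisfies `(g·)^{pⁿ} = 1` for every `g ∈ Γ_{ℚ_v}`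
(`g^{pⁿ} ∈ U_n` acts trivially: inner automorphisms). [cite: SerreLocalFields1979, VII §5 Prop. 3] -/
theorem localLayerConj_toLinearMap_pow_eq_one (n : ℕ) (g : absoluteGaloisGroup (v.adicCompletion ℚ)) :
    (localLayerConj κ v T n g).hom.toLinearMap ^ p ^ n = 1 := by
  haveI := normal_layerGroup κ v n
  exact conjMap_toLinearMap_pow_eq_one T.toTopRep (layerGroup κ v n) (pow_mem_layerGroup κ v g n)

/-- The local trace map commutes with the action of `Γ_{ℚ_v}` (`coresLe_conjMap` for the normal
layers `U_{n+1} ≤ U_n`). [cite: NeukirchSchmidtWingberg2008, I §5 Prop. 1.5.4] -/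
theorem localLayerCores_localLayerConj (n : ℕ) (g : absoluteGaloisGroup (v.adicCompletion ℚ))
    (y : H1 T (layerGroup κ v (n + 1))) :
    localLayerCores κ v T n (localLayerConj κ v T (n + 1) g y) =
      localLayerConj κ v T n g (localLayerCores κ v T n y) := by
  haveI := normal_layerGroup κ v n
  haveI := normal_layerGroup κ v (n + 1)
  letI := localLayerFintypeQuot κ v n (n + 1)
  exact coresLe_conjMap T.toTopRep (layerGroup_antitone κ v (Nat.le_succ n))
    (isOpen_layerGroup κ v (n + 1)) g y

/-- A family `y = (y_n)_n`, `y_n ∈ H¹(ℚ_{n,v}, T)`, is **norm-compatible**: `Cor(y_{n+1}) = y_n` for all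
`n` — an element of `lim←_n H¹(ℚ_{n,v}, T)` written levelwise. [cite: Kato2004Asterisque, §12.2 (p. 220)] -/
def IsLocalNormCompatible (y : ∀ n : ℕ, H1 T (layerGroup κ v n)) : Prop :=
  ∀ n, localLayerCores κ v T n (y (n + 1)) = y n

/-- The norm-compatible families form an `A`-submodule of `∏_n H¹(ℚ_{n,v}, T)`: the inverse limit
`lim←_n H¹(ℚ_{n,v}, T)` written inside the product. [cite: Kato2004Asterisque, §12.2 (p. 220)] -/
def localNormCompatible : Submodule A (∀ n : ℕ, H1 T (layerGroup κ v n)) where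
  carrier := {y | IsLocalNormCompatible κ v T y}
  zero_mem' n := by simp only [Pi.zero_apply, map_zero]
  add_mem' {y y'} hy hy' n := by simp only [Pi.add_apply, map_add, hy n, hy' n]
  smul_mem' a y hy n := by simp only [Pi.smul_apply, map_smul, hy n]

/-- Membership in `localNormCompatible` (unfolding). [cite: Kato2004Asterisque, §12.2 (p. 220)] -/
@[simp] theorem mem_localNormCompatible_iff (y : ∀ n : ℕ, H1 T (layerGroup κ v n)) :
    y ∈ localNormCompatible κ v T ↔ IsLocalNormCompatible κ v T y :=
  Iff.rfl

end LocalLayers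

/-! ## §2 The pinned interface `𝐇¹_loc(T) = lim←_n H¹(ℚ_{n,v}, T)` as a `Λ = ℤ_p⟦X⟧`-module -/

section Interface

variable {p : ℕ} [Fact p.Prime] (κ : ZpExtension ℚ p) (v : HeightOneSpectrum (𝓞 ℚ))
  {M : Type} [AddCommGroup M] [Module ℤ_[p] M] [TopologicalSpace M] [IsTopologicalAddGroup M]
  [ContinuousSMul ℤ_[p] M] (T : GaloisRep (v.adicCompletion ℚ) ℤ_[p] M)
  (γ : absoluteGaloisGroup (v.adicCompletion ℚ))

/-- **Kato's local Iwasawa cohomology `𝐇¹_loc(T) = lim←_n H¹(ℚ_{n,v}, T)`** (§12.2, p. 220: "for a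
finitely generated `ℤ_p`-module `T` endowed with a continuous action of `Gal(ℚ̄_p/ℚ_p), let
`𝐇^q_loc(T) = lim←_n H^q(ℚ_p(ζ_{p^n}), T)`"; the local Iwasawa cohomology of Perrin-Riou 1994), for a
`p`-adic representation `T` of `Γ_{ℚ_v} = Gal(ℚ̄_v/ℚ_v)` along the LOCAL layers
`ℚ_{n,v} = ℚ_n·ℚ_v` of a `ℤ_p`-extension `κ` of `ℚ` (`U_n = CyclotomicLayer.layerGroup κ v n`), as a
`Λ = ℤ_p⟦X⟧`-module with `X = conj_γ − 1` for a chosen `γ ∈ Γ_{ℚ_v}` — hypothesis structure, the exact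
local analogue of `Kato2004.IwasawaH1Data` (module docstring: READING, and why the `Δ`-trivial tower
`ℚ_{n,v}` replaces `ℚ_v(ζ_{p^{n+1}})`).  Data: an abstract `Λ`-module `H` and additive maps
`proj n : H → H¹(ℚ_{n,v}, T)`.  Axioms: `cores_proj` (compatible with the local trace maps),
`proj_injective` and `proj_surjective` (so `(proj n)_n : H ≅ lim←_n H¹(ℚ_{n,v}, T)` as abelian
groups), `proj_T_smul` (`X ∈ Λ` acts as `conj_γ − 1`) and `proj_C_smul` (constants act through the
`ℤ_p`-structure of the levels).  Nothing asserted; EXISTENCE is the theorem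
`nonempty_localIwasawaH1Data` and UNIQUENESS `LocalIwasawaH1Data.exists_linearEquiv` below (both
proved, for every `γ`); no integrality condition (local fields).
[cite: Kato2004Asterisque, §12.2 (p. 220) with (12.2.3)] -/
structure LocalIwasawaH1Data where
  /-- The underlying type of the local Iwasawa cohomology module `𝐇¹_loc(T)`. -/
  H : Type
  /-- `𝐇¹_loc` is an abelian group. -/
  [addCommGroup : AddCommGroup H]
  /-- `𝐇¹_loc` is a `Λ = ℤ_p⟦X⟧`-module. -/
  [module : Module (IwasawaAlgebra p) H]
  /-- The projection to the `n`-th local layer `H¹(ℚ_{n,v}, T)`. -/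
  proj : ∀ n : ℕ, H →+ H1 T (layerGroup κ v n)
  /-- Compatibility with the local trace maps `Cor : H¹(ℚ_{n+1,v}, T) → H¹(ℚ_{n,v}, T)`. -/
  cores_proj : ∀ (n : ℕ) (x : H), localLayerCores κ v T n (proj (n + 1) x) = proj n x
  /-- `(proj n)_n` is injective. -/
  proj_injective : ∀ x : H, (∀ n, proj n x = 0) → x = 0
  /-- `(proj n)_n` is surjective onto the norm-compatible families (the inverse limit). -/
  proj_surjective : ∀ y : (∀ n : ℕ, H1 T (layerGroup κ v n)),
    IsLocalNormCompatible κ v T y → ∃ x : H, ∀ n, proj n x = y n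
  /-- `X` acts as `conj_γ − 1` on every local layer. -/
  proj_T_smul : ∀ (n : ℕ) (x : H),
    proj n ((PowerSeries.X : IwasawaAlgebra p) • x) = localLayerConj κ v T n γ (proj n x) - proj n x
  /-- Constants `c ∈ ℤ_p` act through the `ℤ_p`-module structure of `H¹(ℚ_{n,v}, T)`. -/
  proj_C_smul : ∀ (c : ℤ_[p]) (n : ℕ) (x : H), proj n (PowerSeries.C c • x) = c • proj n x

attribute [instance] LocalIwasawaH1Data.addCommGroup LocalIwasawaH1Data.module

namespace LocalIwasawaH1Data

variable {κ v T γ} (J : LocalIwasawaH1Data κ v T γ)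

/-- The family of projections `x ↦ (proj n x)_n : 𝐇¹_loc → ∏_n H¹(ℚ_{n,v}, T)`.
[cite: Kato2004Asterisque, §12.2 (p. 220)] -/
def toFamily : J.H →+ (∀ n : ℕ, H1 T (layerGroup κ v n)) where
  toFun x n := J.proj n x
  map_zero' := funext fun n ↦ map_zero (J.proj n)
  map_add' x y := funext fun n ↦ map_add (J.proj n) x y

/-- Unfolding `toFamily`. [cite: Kato2004Asterisque, §12.2 (p. 220)] -/
@[simp] theorem toFamily_apply (x : J.H) (n : ℕ) : J.toFamily x n = J.proj n x := rfl

/-- `toFamily` is injective (`proj_injective`). [cite: Kato2004Asterisque, §12.2 (p. 220)] -/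
theorem toFamily_injective : Function.Injective J.toFamily := by
  intro x y h
  rw [← sub_eq_zero]
  refine J.proj_injective _ fun n ↦ ?_
  have := congr_fun h n
  simp only [toFamily_apply] at this
  rw [map_sub, this, sub_self]

/-- **Extensionality of `𝐇¹_loc`:** two elements with the same image in every local layer are equal.
[cite: Kato2004Asterisque, §12.2 (p. 220)] -/
theorem ext_of_proj {x y : J.H} (h : ∀ n, J.proj n x = J.proj n y) : x = y :=
  J.toFamily_injective (funext h)

/-- The image of `𝐇¹_loc` in `∏_n H¹(ℚ_{n,v}, T)` consists of norm-compatible families.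
[cite: Kato2004Asterisque, §12.2 (p. 220)] -/
theorem isLocalNormCompatible_toFamily (x : J.H) : IsLocalNormCompatible κ v T (J.toFamily x) :=
  fun n ↦ J.cores_proj n x

/-- The image of `𝐇¹_loc` in `∏_n H¹(ℚ_{n,v}, T)` IS the set of norm-compatible families.
[cite: Kato2004Asterisque, §12.2 (p. 220)] -/
theorem range_toFamily :
    Set.range J.toFamily = {y | IsLocalNormCompatible κ v T y} := by
  ext y
  constructor
  · rintro ⟨x, rfl⟩
    exact J.isLocalNormCompatible_toFamily x
  · intro hy
    obtain ⟨x, hx⟩ := J.proj_surjective y hy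
    exact ⟨x, funext hx⟩

/-- **The `Λ`-adic class of a norm-compatible local family**: a norm-compatible family `(y_n)_n` of
`∏_n H¹(ℚ_{n,v}, T)` defines a UNIQUE element `𝐲 ∈ 𝐇¹_loc` with `proj n 𝐲 = y_n` for all `n`.
[cite: Kato2004Asterisque, §12.2 (p. 220)] -/
theorem exists_unique_lift {y : ∀ n : ℕ, H1 T (layerGroup κ v n)}
    (hy : IsLocalNormCompatible κ v T y) : ∃! x : J.H, ∀ n, J.proj n x = y n := by
  obtain ⟨x, hx⟩ := J.proj_surjective y hy
  exact ⟨x, hx, fun x' hx' ↦ J.ext_of_proj fun n ↦ by rw [hx n, hx' n]⟩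

/-- **Polynomials act levelwise**: `proj n (r • x) = r(conj_γ − 1) (proj n x)` for every polynomial
`r ∈ ℤ_p[X]` (from `proj_T_smul` and `proj_C_smul`). [cite: Kato2004Asterisque, §12.2 (p. 220)] -/
theorem proj_coe_smul (n : ℕ) (r : ℤ_[p][X]) (x : J.H) :
    J.proj n ((r : PowerSeries ℤ_[p]) • x) =
      aeval ((localLayerConj κ v T n γ).hom.toLinearMap - 1) r (J.proj n x) := by
  induction r using Polynomial.induction_on generalizing x with
  | C c =>
    rw [Polynomial.coe_C, J.proj_C_smul, aeval_C, Module.algebraMap_end_apply]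
  | add f₁ f₂ h₁ h₂ =>
    rw [Polynomial.coe_add, add_smul, map_add, h₁, h₂, map_add, LinearMap.add_apply]
  | monomial k c hk =>
    rw [pow_succ, ← mul_assoc, Polynomial.coe_mul, Polynomial.coe_X, mul_smul, hk, J.proj_T_smul]
    conv_rhs => rw [map_mul, Module.End.mul_apply, aeval_X, LinearMap.sub_apply, Module.End.one_apply]
    rfl

/-- **`ω_n` kills the `n`-th local layer**: `proj n (ω_n • x) = 0` for `ω_n = (X+1)^{pⁿ} − 1`, since
`conj_γ^{pⁿ} = conj_{γ^{pⁿ}} = 1` on `H¹(ℚ_{n,v}, T)`. [cite: Lang1990, Ch. 5 §1 Thm. 1.1] -/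
theorem proj_omega_smul (n : ℕ) (x : J.H) :
    J.proj n ((((X + 1 : ℤ_[p][X]) ^ p ^ n - 1 : ℤ_[p][X]) : PowerSeries ℤ_[p]) • x) = 0 := by
  rw [proj_coe_smul]
  have hθ := localLayerConj_toLinearMap_pow_eq_one κ v T n γ
  simp [map_sub, map_pow, map_add, aeval_X, sub_add_cancel, hθ]

/-- **The `Λ`-action of ANY datum is levelwise (the pin is rigid).**  For every power series `f` and
every polynomial `r ≡ f (mod ω_n)`: `proj n (f • x) = r(conj_γ − 1) (proj n x)` — `f = r + ω_n q`,
`f • x = r • x + ω_n • (q • x)` by commutativity of `Λ`, and the second term dies at level `n`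
whatever `q • x` is (no topology on `H`). [cite: Lang1990, Ch. 5 §1 Thm. 1.1] -/
theorem proj_smul (n : ℕ) {f : PowerSeries ℤ_[p]} {r : ℤ_[p][X]}
    (hfr : f - (r : PowerSeries ℤ_[p]) ∈
      Ideal.span {(((X + 1 : ℤ_[p][X]) ^ p ^ n - 1 : ℤ_[p][X]) : PowerSeries ℤ_[p])})
    (x : J.H) :
    J.proj n (f • x) = aeval ((localLayerConj κ v T n γ).hom.toLinearMap - 1) r (J.proj n x) := by
  obtain ⟨q, hq⟩ := Ideal.mem_span_singleton'.mp hfr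
  have hf : f = (r : PowerSeries ℤ_[p]) +
      (((X + 1 : ℤ_[p][X]) ^ p ^ n - 1 : ℤ_[p][X]) : PowerSeries ℤ_[p]) * q := by
    rw [mul_comm, hq, add_sub_cancel]
  rw [hf, add_smul, mul_smul, map_add, J.proj_omega_smul, add_zero, proj_coe_smul]

variable (J' : LocalIwasawaH1Data κ v T γ)

/-- **Uniqueness of the pin `𝐇¹_loc(T)`**: any two data `J`, `J'` (same `γ`) are isomorphic as
`Λ`-modules by an isomorphism compatible with all the projections (both project bijectively onto the
norm-compatible families, and the `Λ`-actions are levelwise, `proj_smul`).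
[cite: Kato2004Asterisque, §12.2 (p. 220)] [cite: Lang1990, Ch. 5 §1 Thm. 1.1] -/
theorem exists_linearEquiv :
    ∃ e : J.H ≃ₗ[IwasawaAlgebra p] J'.H, ∀ (n : ℕ) (x : J.H), J'.proj n (e x) = J.proj n x := by
  have hex : ∀ x : J.H, ∃ y : J'.H, ∀ n, J'.proj n y = J.proj n x := fun x ↦
    J'.proj_surjective _ (J.isLocalNormCompatible_toFamily x)
  choose e he using hex
  have hadd : ∀ x x', e (x + x') = e x + e x' := fun x x' ↦
    J'.ext_of_proj fun n ↦ by rw [he, map_add, map_add, he, he]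
  have hsmul : ∀ (f : IwasawaAlgebra p) (x : J.H), e (f • x) = f • e x := fun f x ↦
    J'.ext_of_proj fun n ↦ by
      obtain ⟨r, hr⟩ := IwasawaH1Exists.exists_polynomial_sub_coe_mem_span p n f
      rw [he, J.proj_smul n hr, J'.proj_smul n hr, he]
  let eₗ : J.H →ₗ[IwasawaAlgebra p] J'.H :=
    { toFun := e, map_add' := hadd, map_smul' := hsmul }
  have hinj : Function.Injective eₗ := fun x x' h ↦
    J.ext_of_proj fun n ↦ by rw [← he x n, ← he x' n]; exact congrArg (J'.proj n) h
  have hsurj : Function.Surjective eₗ := fun y ↦ by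
    obtain ⟨x, hx⟩ := J.proj_surjective _ (J'.isLocalNormCompatible_toFamily y)
    exact ⟨x, J'.ext_of_proj fun n ↦ (he x n).trans (hx n)⟩
  exact ⟨LinearEquiv.ofBijective eₗ ⟨hinj, hsurj⟩, fun n x ↦ he x n⟩

/-- The isomorphism of `exists_linearEquiv` is unique: two maps `J.H → J'.H` compatible with all the
projections coincide. [cite: Kato2004Asterisque, §12.2 (p. 220)] -/
theorem eq_of_proj_comp_eq {e e' : J.H → J'.H}
    (he : ∀ (n : ℕ) (x : J.H), J'.proj n (e x) = J.proj n x)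
    (he' : ∀ (n : ℕ) (x : J.H), J'.proj n (e' x) = J.proj n x) : e = e' :=
  funext fun x ↦ J'.ext_of_proj fun n ↦ by rw [he, he']

end LocalIwasawaH1Data

end Interface

/-! ## §3 EXISTENCE: `𝐇¹_loc(T)` is a `Λ`-module (the construction, Weierstrass division by `ω_n`) -/

section Existence

variable {p : ℕ} [Fact p.Prime] (κ : ZpExtension ℚ p) (v : HeightOneSpectrum (𝓞 ℚ))
  {M : Type} [AddCommGroup M] [Module ℤ_[p] M] [TopologicalSpace M] [IsTopologicalAddGroup M]
  [ContinuousSMul ℤ_[p] M] (T : GaloisRep (v.adicCompletion ℚ) ℤ_[p] M)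
  (γ : absoluteGaloisGroup (v.adicCompletion ℚ))

/-- A linear map intertwining two endomorphisms intertwines the polynomials in them. [folklore] -/
private theorem map_aeval_apply_of_comp_eq' {M₁ M₂ : Type*} [AddCommGroup M₁] [Module ℤ_[p] M₁]
    [AddCommGroup M₂] [Module ℤ_[p] M₂]
    (g : M₁ →ₗ[ℤ_[p]] M₂) (a : Module.End ℤ_[p] M₁) (b : Module.End ℤ_[p] M₂)
    (h : g ∘ₗ a = b ∘ₗ g) (r : ℤ_[p][X]) (m : M₁) : g (aeval a r m) = aeval b r (g m) := by
  induction r using Polynomial.induction_on generalizing m with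
  | C c => simp
  | add f₁ f₂ h₁ h₂ => simp [h₁, h₂]
  | monomial k c hk =>
    have hc : ∀ m, g (a m) = b (g m) := fun m => by simpa using LinearMap.congr_fun h m
    rw [pow_succ, ← mul_assoc]
    conv_rhs => rw [map_mul, Module.End.mul_apply, aeval_X]
    conv_lhs => rw [map_mul, Module.End.mul_apply, aeval_X]
    rw [hk, hc]

/-- **Kato 2004 §12.2 (12.2.3): the local Iwasawa cohomology `𝐇¹_loc(T)` EXISTS as a
`Λ = ℤ_p⟦X⟧`-module**, for every `p`-adic representation `T` of `Γ_{ℚ_v}`, every `ℤ_p`-extension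
`κ` of `ℚ`, every place `v` and EVERY `γ ∈ Γ_{ℚ_v}`: `LocalIwasawaH1Data κ v T γ` is inhabited.
Construction (the local copy of `IwasawaH1Exists.nonempty_iwasawaH1Data_holds`): `H` is the set of
norm-compatible families `(y_n)_n ∈ ∏_n H¹(ℚ_{n,v}, T)` (the inverse limit along the local trace maps,
written inside the product), `proj n` the `n`-th coordinate; `Λ` acts on the `n`-th level through
`Λ/(ω_n) ≅ ℤ_p[X]/(ω_n)` (Weierstrass division by the distinguished polynomial
`ω_n = (X+1)^{pⁿ} − 1`, `IwasawaH1Exists.exists_ringHom_of_pow_eq_one`), `X ↦ conj_γ − 1`, well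
defined because `γ^{pⁿ} ∈ U_n` acts trivially (`ω_n(conj_γ − 1) = 0`); the levelwise actions commute
with the trace maps (`localLayerCores_localLayerConj`) and `ω_n ∣ ω_{n+1}`, so they restrict to `H`.
No topology on the levels and no finiteness theorem is used ("the following are known: …
`𝐇¹_loc(T)` … finitely generated" is NOT used and NOT proved here).
[cite: Kato2004Asterisque, §12.2 (p. 220) with (12.2.3)] [cite: Lang1990, Ch. 5 §1 Thm. 1.1] -/
theorem nonempty_localIwasawaH1Data : Nonempty (LocalIwasawaH1Data κ v T γ) := by
  -- the level operators `θ_n = conj_γ` on `H¹(ℚ_{n,v}, T)` and `θ_n^{p^n} = 1`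
  let θ : ∀ n, Module.End ℤ_[p] (H1 T (layerGroup κ v n)) := fun n ↦
    (localLayerConj κ v T n γ).hom.toLinearMap
  have hθ : ∀ n (c : H1 T (layerGroup κ v n)), θ n c = localLayerConj κ v T n γ c := fun _ _ ↦ rfl
  have hθpow : ∀ n, θ n ^ p ^ n = 1 := fun n ↦ localLayerConj_toLinearMap_pow_eq_one κ v T n γ
  -- the `Λ`-action on each level through `Λ/(ω_n) ≅ ℤ_p[X]/(ω_n)`
  choose ψ hψ using fun n ↦ IwasawaH1Exists.exists_ringHom_of_pow_eq_one p (θ n) n (hθpow n)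
  letI inst : ∀ n, Module (IwasawaAlgebra p) (H1 T (layerGroup κ v n)) :=
    fun n ↦ Module.compHom _ (ψ n)
  have smul_def : ∀ (n : ℕ) (f : IwasawaAlgebra p) (m : H1 T (layerGroup κ v n)),
      f • m = ψ n f m := fun _ _ _ ↦ rfl
  have hψcoe : ∀ (n : ℕ) (r : ℤ_[p][X]), ψ n (r : PowerSeries ℤ_[p]) = aeval (θ n - 1) r :=
    fun n r ↦ hψ n _ r (by rw [sub_self]; exact Submodule.zero_mem _)
  have hψX : ∀ n, ψ n (PowerSeries.X : IwasawaAlgebra p) = θ n - 1 := fun n ↦ by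
    rw [← Polynomial.coe_X, hψcoe, aeval_X]
  have hψC : ∀ (n : ℕ) (c : ℤ_[p]), ψ n (PowerSeries.C c : IwasawaAlgebra p) =
      algebraMap ℤ_[p] _ c := fun n c ↦ by
    rw [← Polynomial.coe_C, hψcoe, aeval_C]
  -- compatibility of `θ_n − 1` with the local trace maps
  have hcomm : ∀ n, (localLayerCores κ v T n) ∘ₗ (θ (n + 1) - 1) =
      (θ n - 1) ∘ₗ (localLayerCores κ v T n) := by
    intro n
    refine LinearMap.ext fun y ↦ ?_
    simp only [LinearMap.coe_comp, Function.comp_apply, LinearMap.sub_apply, Module.End.one_apply,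
      map_sub, hθ, localLayerCores_localLayerConj]
  -- the `Λ`-submodule of norm-compatible families
  let N : Submodule (IwasawaAlgebra p) (∀ n : ℕ, H1 T (layerGroup κ v n)) :=
    { carrier := {y | IsLocalNormCompatible κ v T y}
      zero_mem' := (localNormCompatible κ v T).zero_mem
      add_mem' := fun ha hb ↦ (localNormCompatible κ v T).add_mem ha hb
      smul_mem' := fun f y hy n ↦ by
        obtain ⟨r, hr⟩ := IwasawaH1Exists.exists_polynomial_sub_coe_mem_span p (n + 1) f
        rw [Pi.smul_apply, Pi.smul_apply, smul_def, smul_def, hψ (n + 1) f r hr,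
          hψ n f r (IwasawaH1Exists.span_omega_succ_le p n hr),
          map_aeval_apply_of_comp_eq' _ _ _ (hcomm n), hy n] }
  refine ⟨{
    H := N
    proj := fun n ↦
      { toFun := fun x ↦ (x : ∀ n : ℕ, H1 T (layerGroup κ v n)) n
        map_zero' := rfl
        map_add' := fun _ _ ↦ rfl }
    cores_proj := fun n x ↦ x.2 n
    proj_injective := fun x hx ↦ Subtype.ext (funext hx)
    proj_surjective := fun y hy ↦ ⟨⟨y, hy⟩, fun _ ↦ rfl⟩
    proj_T_smul := fun n x ↦ ?_
    proj_C_smul := fun c n x ↦ ?_ }⟩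
  · change ψ n PowerSeries.X ((x : ∀ n : ℕ, H1 T (layerGroup κ v n)) n) = _
    rw [hψX, LinearMap.sub_apply, Module.End.one_apply, hθ]
    rfl
  · change ψ n (PowerSeries.C c) ((x : ∀ n : ℕ, H1 T (layerGroup κ v n)) n) = _
    rw [hψC, Module.algebraMap_end_apply]
    rfl

end Existence

/-! ## §4 The localisation `loc_v : 𝐇¹_Γ(T) → 𝐇¹_loc(T|_{Γ_{ℚ_v}})` from Kato's global `𝐇¹` -/

section LayerLoc

variable {A : Type} [CommRing A] [TopologicalSpace A] {M : Type} [AddCommGroup M] [Module A M]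
  [TopologicalSpace M] [IsTopologicalAddGroup M] [ContinuousSMul A M]
  (T : GaloisRep ℚ A M) {p : ℕ} [Fact p.Prime] (κ : ZpExtension ℚ p) (v : HeightOneSpectrum (𝓞 ℚ))

/-- The restriction `res_n : U_n = Gal(ℚ̄_v/ℚ_{n,v}) → Γ_n = Gal(ℚ̄/ℚ_n)` of `Γ_{ℚ_v} → Γ_ℚ` (the chosen
embedding `closureEmb ℚ_v`; the tree's `resGalSubgroupOfEmb`). [folklore] -/
abbrev layerRes (n : ℕ) : layerGroup κ v n →ₜ* κ.layerSubgroup n :=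
  resGalSubgroupOfEmb (κ.layerSubgroup n) (closureEmb (K := ℚ) (v.adicCompletion ℚ))

/-- The module half (identity on `T`) of the compatible pair `(res_n, id)` defining the localisation
`H¹(ℚ_n, T) → H¹(ℚ_{n,v}, T)`: `T|_{Γ_n}` pulled back along `res_n` IS `(T|_{Γ_{ℚ_v}})|_{U_n}`.
[folklore] -/
def layerLocRepHom (n : ℕ) :
    TopRep.res (layerRes κ v n : layerGroup κ v n →* κ.layerSubgroup n)
        (subgroupRep T.toTopRep (κ.layerSubgroup n)) ⟶
      subgroupRep (T.toLocal v).toTopRep (layerGroup κ v n) :=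
  TopRep.ofHom ⟨ContinuousLinearMap.id A M, fun _ => rfl⟩

/-- **Localisation at the `n`-th layer**: `loc_n : H¹(ℚ_n, T) → H¹(ℚ_{n,v}, T)`, the pull-back along
`res_n : U_n → Γ_n` with the identity on coefficients (Kato (17.13.1): the map `𝐇¹ → 𝐇¹_loc` is the
inverse limit of these; Rubin Ch. I §5 `H¹(K, ·) → H¹(K_v, ·)`). [cite: Kato2004Asterisque, §17.13 (17.13.1) (p. 279)] -/
def layerLoc (n : ℕ) : H1 T (κ.layerSubgroup n) ⟶ H1 (T.toLocal v) (layerGroup κ v n) :=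
  ContinuousCohomology.map (layerRes κ v n) (layerLocRepHom T κ v n) 1

/-- `layerLoc` on explicit cocycles: `loc_n [φ] = [φ ∘ res_n]` (restriction of cocycles along a
homomorphism, Serre I §2.4 "compatible pairs"). [cite: SerreGaloisCohomology1997, I §2.4] -/
theorem layerLoc_oneCocycleClass (n : ℕ) (φ : contOneCocycles (subgroupRep T.toTopRep (κ.layerSubgroup n))) :
    layerLoc T κ v n (oneCocycleClass _ φ) =
      oneCocycleClass _ (contOneCocycles.pullback (layerRes κ v n) (layerLocRepHom T κ v n) φ) :=
  map_oneCocycleClass _ _ _ φ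

/-- **`loc_n` is `Γ_{ℚ_v}`-equivariant**: for `g ∈ Γ_{ℚ_v}` with image `res g ∈ Γ_ℚ`,
`loc_n (res g · y) = g · loc_n y` (conjugation commutes with restriction along a homomorphism, NSW
Prop. 1.5.4; on cocycles both sides are `x ↦ g • φ((res g)⁻¹ (res x) (res g))`).
[cite: NeukirchSchmidtWingberg2008, I §5 Prop. 1.5.4] -/
theorem layerLoc_conjMap (n : ℕ) (g : absoluteGaloisGroup (v.adicCompletion ℚ))
    (y : H1 T (κ.layerSubgroup n)) :
    layerLoc T κ v n (conjMap T.toTopRep (κ.layerSubgroup n)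
        (resGalOfEmb (closureEmb (K := ℚ) (v.adicCompletion ℚ)) g) 1 y) =
      (haveI := normal_layerGroup κ v n;
        conjMap (T.toLocal v).toTopRep (layerGroup κ v n) g 1 (layerLoc T κ v n y)) := by
  haveI := normal_layerGroup κ v n
  obtain ⟨φ, rfl⟩ := oneCocycleClass_surjective _ y
  rw [conjMap_oneCocycleClass, layerLoc_oneCocycleClass, layerLoc_oneCocycleClass,
    conjMap_oneCocycleClass]
  refine congrArg _ (Subtype.ext (ContinuousMap.ext fun x => ?_))
  have harg : layerRes κ v n (subgroupConj (layerGroup κ v n) g x) =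
      subgroupConj (κ.layerSubgroup n) (resGalOfEmb (closureEmb (K := ℚ) (v.adicCompletion ℚ)) g)
        (layerRes κ v n x) :=
    Subtype.ext (by simp [subgroupConj_apply_coe, resGalSubgroupOfEmb_apply_coe, map_mul, map_inv])
  rw [contOneCocycles.pullback_apply, conj_pullback_apply, conj_pullback_apply,
    contOneCocycles.pullback_apply, harg]
  rfl

/-- The coset condition of the transport lemma: if `κ ∘ res_v : Γ_{ℚ_v} → ℤ_p` is onto ("one prime of
`ℚ_∞` above `v`", e.g. `v = p` totally ramified in the cyclotomic tower), then `res_n(U_n)·Γ_{n+1} = Γ_n`: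
every `g ∈ Γ_n` is `res_n(g')` times an element of `Γ_{n+1}` (indeed of `ker κ`).
[cite: Washington1997, §13.1] -/
theorem exists_layerRes_inv_mul_mem
    (hsurj : Function.Surjective
      (κ.toContinuousMonoidHom.comp (resGalOfEmb (closureEmb (K := ℚ) (v.adicCompletion ℚ)))))
    (n : ℕ) (g : κ.layerSubgroup n) :
    ∃ g' : layerGroup κ v n, ((layerRes κ v n g' : κ.layerSubgroup n) : absoluteGaloisGroup ℚ)⁻¹ *
        (g : absoluteGaloisGroup ℚ) ∈ κ.layerSubgroup (n + 1) := by
  obtain ⟨τ, hτ⟩ := hsurj (κ (g : absoluteGaloisGroup ℚ))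
  have hτ' : κ (resGalOfEmb (closureEmb (K := ℚ) (v.adicCompletion ℚ)) τ) =
      κ (g : absoluteGaloisGroup ℚ) := hτ
  have hτmem : τ ∈ layerGroup κ v n := by
    rw [Kobayashi2003.mem_localLayerSubgroupOfEmb_iff, hτ']
    exact ZpExtension.mem_layerSubgroup.mp g.2
  refine ⟨⟨τ, hτmem⟩, ?_⟩
  apply κ.kerSubgroup_le_layerSubgroup (n + 1)
  rw [ZpExtension.mem_kerSubgroup, map_mul, map_inv, resGalSubgroupOfEmb_apply_coe, hτ',
    inv_mul_cancel]

/-- `Kato2004.layerCores` is the relative corestriction `coresLe` of `Γ_{n+1} ≤ Γ_n`, for ANY finiteness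
structure on `Γ_n ⧸ Γ_{n+1}` (`coresLe` does not depend on it). [cite: Kato2004Asterisque, §12.2 (p. 220)] -/
theorem layerCores_eq_coresLe (n : ℕ)
    [inst : Fintype (κ.layerSubgroup n ⧸ (κ.layerSubgroup (n + 1)).subgroupOf (κ.layerSubgroup n))]
    (y : H1 T (κ.layerSubgroup (n + 1))) :
    layerCores T κ n y =
      coresLe T.toTopRep (κ.layerSubgroup_antitone (Nat.le_succ n)) (κ.isOpen_layerSubgroup (n + 1)) y := by
  haveI hfi : (κ.layerSubgroup (n + 1)).FiniteIndex :=
    finiteIndex_of_isOpen_of_compactSpace _ (κ.isOpen_layerSubgroup (n + 1))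
  obtain rfl : inst = Fintype.ofFinite _ := Subsingleton.elim _ _
  rfl

/-- `localLayerCores` is the relative corestriction `coresLe` of `U_{n+1} ≤ U_n`, for ANY finiteness
structure on `U_n ⧸ U_{n+1}`. [cite: Kato2004Asterisque, §12.2 (p. 220)] -/
theorem localLayerCores_eq_coresLe {A' : Type} [CommRing A'] [TopologicalSpace A'] {M' : Type}
    [AddCommGroup M'] [Module A' M'] [TopologicalSpace M'] [IsTopologicalAddGroup M']
    [ContinuousSMul A' M'] (T' : GaloisRep (v.adicCompletion ℚ) A' M') (n : ℕ)
    [inst : Fintype (layerGroup κ v n ⧸ (layerGroup κ v (n + 1)).subgroupOf (layerGroup κ v n))]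
    (w : H1 T' (layerGroup κ v (n + 1))) :
    localLayerCores κ v T' n w =
      coresLe T'.toTopRep (layerGroup_antitone κ v (Nat.le_succ n)) (isOpen_layerGroup κ v (n + 1)) w := by
  obtain rfl : inst = localLayerFintypeQuot κ v n (n + 1) := Subsingleton.elim _ _
  rfl

end LayerLoc

/-! ### Relative corestriction commutes with pull-back along a homomorphism meeting every coset
(abstract groups and coefficients: the single-double-coset Mackey formula for `coresLe`) -/

section TransportRelative

variable {R : Type} [Ring R] [TopologicalSpace R]
  {G G' : Type} [Group G] [TopologicalSpace G] [IsTopologicalGroup G]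
  [Group G'] [TopologicalSpace G'] [IsTopologicalGroup G']

/-- **`coresLe` commutes with pull-back along compatible homomorphisms meeting every coset.**
Abstract transport statement (arbitrary topological groups `G`, `G'`, topological `R`-modules `X`, `X'`)
generalising the tree's `cores_map_eq_map_cores_of_forall_exists` (absolute corestriction, pull-back
along ONE homomorphism with `N' = θ⁻¹N`) to the RELATIVE corestrictions `coresLe` of two towers
`H ≤ H' ≤ G`, `L ≤ L' ≤ G'` linked by continuous homomorphisms `θ' : L' → H'`, `θ : L → H` that agree on
`L` (`hθ`), with `θ'⁻¹(H) ∩ L' = L` (`hmem`) and `θ'(L')·H = H'` (`hcos`), and compatible coefficient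
maps `f'`, `f` that agree (`hff`): `H¹(θ', f') ∘ cor_{H'/H} = cor_{L'/L} ∘ H¹(θ, f)` on `H¹(H, X)`.
On cocycles both sides are the same transfer sum once the representatives of `H' ⧸ H` are chosen inside
`θ'(L')` and transported to `L' ⧸ L` along the bijection `θ̄'` (NSW (1.5.6)–(1.5.7), the single double
coset).  Stated abstractly so that its instances at concrete Galois representations are kernel-cheap
(cf. `resLe_oneCocycleClass_eq_of_forall_apply` in `Kato2004/IwasawaH1TorsionFreeProofs`).
[cite: NeukirchSchmidtWingberg2008, I §5 Prop. 1.5.4 and (1.5.6)] -/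
theorem map_coresLe_eq_coresLe_map (X : TopRep.{0} R G) (X' : TopRep.{0} R G')
    {H H' : Subgroup G} (h : H ≤ H') (hH : IsOpen (H : Set G)) [Fintype (H' ⧸ H.subgroupOf H')]
    {L L' : Subgroup G'} (hL : L ≤ L') (hLo : IsOpen (L : Set G')) [Fintype (L' ⧸ L.subgroupOf L')]
    (θ' : L' →ₜ* H') (θ : L →ₜ* H)
    (hθ : ∀ x : L, ((θ x : H) : G) = ((θ' ⟨x, hL x.2⟩ : H') : G))
    (hmem : ∀ x : L', ((θ' x : H') : G) ∈ H ↔ (x : G') ∈ L)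
    (hcos : ∀ g : H', ∃ g' : L', (θ' g')⁻¹ * g ∈ H.subgroupOf H')
    (f' : TopRep.res (θ' : L' →* H') (subgroupRep X H') ⟶ subgroupRep X' L')
    (f : TopRep.res (θ : L →* H) (subgroupRep X H) ⟶ subgroupRep X' L)
    (hff : ∀ m, f.hom m = f'.hom m)
    (y : continuousCohomology 1 (subgroupRep X H)) :
    ContinuousCohomology.map θ' f' 1 (coresLe X h hH y) =
      coresLe X' hL hLo (ContinuousCohomology.map θ f 1 y) := by
  classical
  -- notation: `N₁ = H ≤ H'`, `N₂ = L ≤ L'` as subgroups of `H'`, `L'`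
  let N₁ : Subgroup H' := H.subgroupOf H'
  let N₂ : Subgroup L' := L.subgroupOf L'
  -- `θ'⁻¹(N₁) = N₂`
  have hmemN : ∀ g' : L', θ' g' ∈ N₁ ↔ g' ∈ N₂ := fun g' ↦ by
    simp only [N₁, N₂, Subgroup.mem_subgroupOf]
    exact hmem g'
  -- representatives of `H' ⧸ N₁` inside the image of `θ'`
  let σ : H' ⧸ N₁ → L' := fun c ↦ (hcos c.out).choose
  have hσ : ∀ c : H' ⧸ N₁, (θ' (σ c))⁻¹ * c.out ∈ N₁ := fun c ↦ (hcos c.out).choose_spec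
  let s₁ : H' ⧸ N₁ → H' := fun c ↦ θ' (σ c)
  have hs₁ : ∀ x : H' ⧸ N₁, (s₁ x : H' ⧸ N₁) = x := fun c ↦ by
    conv_rhs => rw [← QuotientGroup.out_eq' c]
    exact QuotientGroup.eq.mpr (hσ c)
  -- `θ̄' : L' ⧸ N₂ → H' ⧸ N₁`, a bijection
  let θbar : L' ⧸ N₂ → H' ⧸ N₁ :=
    Quotient.map' (fun g' ↦ θ' g') (fun a b hab ↦ by
      rw [QuotientGroup.leftRel_apply] at hab ⊢
      rw [← map_inv, ← map_mul]
      exact (hmemN _).mpr hab)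
  have hθbar : ∀ g' : L', θbar (g' : L' ⧸ N₂) = ((θ' g' : H') : H' ⧸ N₁) := fun _ ↦ rfl
  have hθbar_bij : Function.Bijective θbar := by
    constructor
    · intro a b hab
      induction a using QuotientGroup.induction_on with
      | H a =>
        induction b using QuotientGroup.induction_on with
        | H b =>
          rw [hθbar, hθbar, QuotientGroup.eq] at hab
          apply QuotientGroup.eq.mpr
          rw [← hmemN, map_mul, map_inv]
          exact hab
    · intro x
      induction x using QuotientGroup.induction_on with
      | H g =>
        obtain ⟨g', hg'⟩ := hcos g
        exact ⟨(g' : L' ⧸ N₂), by rw [hθbar]; exact QuotientGroup.eq.mpr hg'⟩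
  let ebar : L' ⧸ N₂ ≃ H' ⧸ N₁ := Equiv.ofBijective θbar hθbar_bij
  -- the transported representatives of `L' ⧸ N₂`
  let s₂ : L' ⧸ N₂ → L' := fun x' ↦ σ (ebar x')
  have hθs₂ : ∀ x', θ' (s₂ x') = s₁ (ebar x') := fun _ ↦ rfl
  have hs₂ : ∀ x' : L' ⧸ N₂, (s₂ x' : L' ⧸ N₂) = x' := fun x' ↦ by
    induction x' using QuotientGroup.induction_on with
    | H a =>
      refine (QuotientGroup.eq.mpr ?_).symm
      rw [← hmemN, map_mul, map_inv, hθs₂]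
      have h1 : ebar (a : L' ⧸ N₂) = ((θ' a : H') : H' ⧸ N₁) := hθbar a
      rw [h1]
      exact QuotientGroup.eq.mp (hs₁ _).symm
  -- `θ̄'` is `L'`-equivariant
  have hsmul : ∀ (g' : L') (x' : L' ⧸ N₂), ebar (g' • x') = θ' g' • ebar x' := fun g' x' ↦ by
    induction x' using QuotientGroup.induction_on with
    | H a =>
      change θbar ((g' * a : L') : L' ⧸ N₂) = θ' g' • θbar (a : L' ⧸ N₂)
      rw [hθbar, hθbar, map_mul, MulAction.Quotient.smul_coe, smul_eq_mul]
  -- `θ'` of the transported Schreier elements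
  have hschreier : ∀ (g' : L') (x' : L' ⧸ N₂),
      θ' ((schreierElt N₂ hs₂ g' x' : N₂) : L') =
        ((schreierElt N₁ hs₁ (θ' g') (ebar x') : N₁) : H') := fun g' x' ↦ by
    rw [schreierElt_coe, schreierElt_coe, map_mul, map_mul, map_inv, hθs₂, hθs₂, hsmul]
  -- `f'` intertwines
  have hf' : ∀ (u : L') (m : X), f'.hom (X.ρ (θ' u : H') m) = X'.ρ (u : G') (f'.hom m) :=
    fun u m ↦ TopRep.hom_comm_apply f' u m
  -- both sides as classes of explicit cocycles on `L'`
  obtain ⟨φ, rfl⟩ := oneCocycleClass_surjective _ y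
  rw [coresLe_oneCocycleClass X h hH hs₁, map_oneCocycleClass, map_oneCocycleClass,
    coresLe_oneCocycleClass X' hL hLo hs₂]
  refine congrArg _ (Subtype.ext (ContinuousMap.ext fun g' ↦ ?_))
  rw [transferCocycle_apply, contOneCocycles.pullback_apply, transferCocycle_apply, transferFun_apply,
    transferFun_apply, map_sum, ← ebar.sum_comp]
  refine Finset.sum_congr rfl fun x' _ ↦ ?_
  rw [← hsmul, ← hθs₂ (g' • x')]
  -- the arguments of `φ` agree in `G`
  have hval : ((subgroupOfHom h (schreierElt N₁ hs₁ (θ' g') (ebar x')) : H) : G) =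
      ((θ (subgroupOfHom hL (schreierElt N₂ hs₂ g' x')) : H) : G) := by
    rw [subgroupOfHom_apply_coe, hθ, ← hschreier]
    rfl
  have harg : subgroupOfHom h (schreierElt N₁ hs₁ (θ' g') (ebar x')) =
      θ (subgroupOfHom hL (schreierElt N₂ hs₂ g' x')) := Subtype.ext hval
  simp only [contOneCocycles.pullback_apply, TopRep.hom_ofHom]
  rw [harg, hff]
  exact hf' _ _

end TransportRelative

section LayerLocCores

variable {A : Type} [CommRing A] [TopologicalSpace A] {M : Type} [AddCommGroup M] [Module A M]
  [TopologicalSpace M] [IsTopologicalAddGroup M] [ContinuousSMul A M]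
  (T : GaloisRep ℚ A M) {p : ℕ} [Fact p.Prime] (κ : ZpExtension ℚ p) (v : HeightOneSpectrum (𝓞 ℚ))

/-- `res_{n+1}` and `res_n` agree on `U_{n+1}` (both are `res_v`).  Proved by one-sided unfolding
(`resGalSubgroupOfEmb_apply_coe` on each side): a direct `rfl` would make the kernel compare
`Γ_{n+1}` with `Γ_n`. [folklore] -/
private theorem layerRes_succ_coe (n : ℕ) (x : layerGroup κ v (n + 1)) :
    ((layerRes κ v (n + 1) x : κ.layerSubgroup (n + 1)) : absoluteGaloisGroup ℚ) =
      ((layerRes κ v n ⟨x, layerGroup_antitone κ v (Nat.le_succ n) x.2⟩ : κ.layerSubgroup n) :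
        absoluteGaloisGroup ℚ) := by
  rw [resGalSubgroupOfEmb_apply_coe, resGalSubgroupOfEmb_apply_coe]

/-- `res_n(x) ∈ Γ_{n+1} ↔ x ∈ U_{n+1}` (`U_{n+1} = res_v⁻¹ Γ_{n+1}`). [folklore] -/
private theorem layerRes_coe_mem_iff (n : ℕ) (x : layerGroup κ v n) :
    ((layerRes κ v n x : κ.layerSubgroup n) : absoluteGaloisGroup ℚ) ∈ κ.layerSubgroup (n + 1) ↔
      (x : absoluteGaloisGroup (v.adicCompletion ℚ)) ∈ layerGroup κ v (n + 1) := by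
  rw [resGalSubgroupOfEmb_apply_coe]
  exact (mem_localSubgroupOfEmb_iff _ _ _).symm

/-- The coefficient map of `loc_n` is the identity on `T`. [folklore] -/
private theorem layerLocRepHom_hom_apply (n : ℕ) (m : M) : (layerLocRepHom T κ v n).hom m = m := rfl

/-- **Localisation commutes with the trace maps** when `κ ∘ res_v` is onto:
`loc_n ∘ Cor_{ℚ_{n+1}/ℚ_n} = Cor_{ℚ_{n+1,v}/ℚ_{n,v}} ∘ loc_{n+1}` on `H¹(ℚ_{n+1}, T)` — the instance of
`map_coresLe_eq_coresLe_map` for `res_n : U_n → Γ_n`, `res_{n+1} : U_{n+1} → Γ_{n+1}`, whose images meet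
every coset of `Γ_{n+1}` in `Γ_n` (`exists_layerRes_inv_mul_mem`). So `(loc_n)_n` maps norm-compatible
families to norm-compatible families. [cite: NeukirchSchmidtWingberg2008, I §5 Prop. 1.5.4 and (1.5.6)] -/
theorem layerLoc_layerCores
    (hsurj : Function.Surjective
      (κ.toContinuousMonoidHom.comp (resGalOfEmb (closureEmb (K := ℚ) (v.adicCompletion ℚ)))))
    (n : ℕ) (y : H1 T (κ.layerSubgroup (n + 1))) :
    layerLoc T κ v n (layerCores T κ n y) =
      localLayerCores κ v (T.toLocal v) n (layerLoc T κ v (n + 1) y) := by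
  haveI hfi : (κ.layerSubgroup (n + 1)).FiniteIndex :=
    finiteIndex_of_isOpen_of_compactSpace _ (κ.isOpen_layerSubgroup (n + 1))
  letI i1 : Fintype (κ.layerSubgroup n ⧸ (κ.layerSubgroup (n + 1)).subgroupOf (κ.layerSubgroup n)) :=
    Fintype.ofFinite _
  letI i2 := localLayerFintypeQuot κ v n (n + 1)
  have hcos : ∀ g : κ.layerSubgroup n, ∃ g' : layerGroup κ v n,
      (layerRes κ v n g')⁻¹ * g ∈ (κ.layerSubgroup (n + 1)).subgroupOf (κ.layerSubgroup n) :=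
    fun g ↦ by
      obtain ⟨g', hg'⟩ := exists_layerRes_inv_mul_mem κ v hsurj n g
      exact ⟨g', Subgroup.mem_subgroupOf.mpr hg'⟩
  have hff : ∀ m : M, (layerLocRepHom T κ v (n + 1)).hom m = (layerLocRepHom T κ v n).hom m :=
    fun m ↦ by rw [layerLocRepHom_hom_apply, layerLocRepHom_hom_apply]
  rw [layerCores_eq_coresLe T κ n, localLayerCores_eq_coresLe κ v (T.toLocal v) n]
  exact map_coresLe_eq_coresLe_map T.toTopRep (T.toLocal v).toTopRep
    (κ.layerSubgroup_antitone (Nat.le_succ n)) (κ.isOpen_layerSubgroup (n + 1))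
    (layerGroup_antitone κ v (Nat.le_succ n)) (isOpen_layerGroup κ v (n + 1))
    (layerRes κ v n) (layerRes κ v (n + 1)) (layerRes_succ_coe κ v n) (layerRes_coe_mem_iff κ v n) hcos
    (layerLocRepHom T κ v n) (layerLocRepHom T κ v (n + 1)) hff y

/-- **For the cyclotomic `ℤ_p`-extension and the place `v ∣ p`, `κ ∘ res_v` IS onto** (`p` is totally
ramified in `ℚ_∞/ℚ`; the tree's `ZpExtension.IsCyclotomic.exists_apply_resGalOfEmb_adicCompletion_eq`),
so all the localisation statements of this file apply unconditionally at `v = p`.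
[cite: Washington1997, §13.1 and Prop. 13.2] -/
theorem surjective_comp_resGalOfEmb_of_isCyclotomic (hκ : κ.IsCyclotomic) (hv : (p : 𝓞 ℚ) ∈ v.asIdeal) :
    Function.Surjective
      (κ.toContinuousMonoidHom.comp (resGalOfEmb (closureEmb (K := ℚ) (v.adicCompletion ℚ)))) :=
  fun t ↦ hκ.exists_apply_resGalOfEmb_adicCompletion_eq v hv t

end LayerLocCores

section Loc

variable {W : WeierstrassCurve ℚ} [W.IsElliptic] {p : ℕ} [Fact p.Prime]
  [ContinuousSMul ℤ_[p] (W.tateModule p)] {κ : ZpExtension ℚ p} {γ : absoluteGaloisGroup ℚ}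
  {v : HeightOneSpectrum (𝓞 ℚ)} {γᵥ : absoluteGaloisGroup (v.adicCompletion ℚ)}
  (I : IwasawaH1Data W p κ γ) (J : LocalIwasawaH1Data κ v ((tateRep W p).toLocal v) γᵥ)

namespace IwasawaH1Data

/-- The levelwise localisations of an element of `𝐇¹_Γ(T_pW)`: the family `(loc_n (proj n x))_n`.
[cite: Kato2004Asterisque, §17.13 (17.13.1) (p. 279)] -/
def locFamily (I : IwasawaH1Data W p κ γ) (v : HeightOneSpectrum (𝓞 ℚ)) (x : I.H) :
    ∀ n : ℕ, H1 ((tateRep W p).toLocal v) (layerGroup κ v n) :=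
  fun n ↦ layerLoc (tateRep W p) κ v n (I.proj n x)

/-- Unfolding `locFamily`. [cite: Kato2004Asterisque, §17.13 (17.13.1) (p. 279)] -/
@[simp] theorem locFamily_apply (v : HeightOneSpectrum (𝓞 ℚ)) (x : I.H) (n : ℕ) :
    I.locFamily v x n = layerLoc (tateRep W p) κ v n (I.proj n x) := rfl

/-- The levelwise localisations of `x ∈ 𝐇¹_Γ(T_pW)` form a norm-compatible LOCAL family when
`κ ∘ res_v` is onto (`layerLoc_layerCores` and `cores_proj`). [cite: Kato2004Asterisque, §17.13 (17.13.1) (p. 279)] -/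
theorem isLocalNormCompatible_locFamily
    (hsurj : Function.Surjective
      (κ.toContinuousMonoidHom.comp (resGalOfEmb (closureEmb (K := ℚ) (v.adicCompletion ℚ)))))
    (x : I.H) : IsLocalNormCompatible κ v ((tateRep W p).toLocal v) (I.locFamily v x) := fun n ↦ by
  rw [locFamily_apply, locFamily_apply, ← layerLoc_layerCores _ κ v hsurj, I.cores_proj]

/-- `(res γᵥ)⁻¹ γ ∈ Γ_n` for all `n` when `γ ∈ Γ_ℚ` and `res γᵥ`, `γᵥ ∈ Γ_{ℚ_v}`, are both normalised
topological generators (`κ(res γᵥ) = κ(γ) = 1`, so the quotient lies in `ker κ ≤ Γ_n`): the global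
operator `conj_γ` on `H¹(ℚ_n, T)` IS `conj_{res γᵥ}` (`conjMap_apply_one_eq_of_inv_mul_mem`).
[cite: Washington1997, §13.2] -/
theorem inv_mul_mem_layerSubgroup_of_isTopGenerator (hγ : κ.IsTopGenerator γ)
    (hγᵥ : κ.IsTopGenerator (resGalOfEmb (closureEmb (K := ℚ) (v.adicCompletion ℚ)) γᵥ)) (n : ℕ) :
    (resGalOfEmb (closureEmb (K := ℚ) (v.adicCompletion ℚ)) γᵥ)⁻¹ * γ ∈ κ.layerSubgroup n := by
  apply κ.kerSubgroup_le_layerSubgroup n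
  have h1 : κ (resGalOfEmb (closureEmb (K := ℚ) (v.adicCompletion ℚ)) γᵥ) = κ γ := by
    rw [show κ γ = Multiplicative.ofAdd 1 from hγ]; exact hγᵥ
  rw [ZpExtension.mem_kerSubgroup, map_mul, map_inv, h1, inv_mul_cancel]

/-- `loc_n` intertwines the LEVEL OPERATORS of the two pins: `loc_n ∘ (conj_γ − 1) = (conj_{γᵥ} − 1) ∘ loc_n`
on `H¹(ℚ_n, T_pW)`, for normalised topological generators `γ`, `res γᵥ` (`layerLoc_conjMap` and the
previous lemma). [cite: NeukirchSchmidtWingberg2008, I §5 Prop. 1.5.4] -/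
theorem layerLoc_comp_conj_sub_one (hγ : κ.IsTopGenerator γ)
    (hγᵥ : κ.IsTopGenerator (resGalOfEmb (closureEmb (K := ℚ) (v.adicCompletion ℚ)) γᵥ)) (n : ℕ) :
    (layerLoc (tateRep W p) κ v n).hom.toLinearMap ∘ₗ
        ((conjMap (tateRep W p).toTopRep (κ.layerSubgroup n) γ 1).hom.toLinearMap - 1) =
      ((localLayerConj κ v ((tateRep W p).toLocal v) n γᵥ).hom.toLinearMap - 1) ∘ₗ
        (layerLoc (tateRep W p) κ v n).hom.toLinearMap := by
  refine LinearMap.ext fun y ↦ ?_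
  simp only [LinearMap.coe_comp, Function.comp_apply, LinearMap.sub_apply, Module.End.one_apply,
    map_sub]
  rw [localLayerConj_eq]
  change layerLoc (tateRep W p) κ v n (conjMap (tateRep W p).toTopRep (κ.layerSubgroup n) γ 1 y) - _ = _
  rw [conjMap_apply_one_eq_of_inv_mul_mem (tateRep W p).toTopRep (κ.layerSubgroup n)
      (inv_mul_mem_layerSubgroup_of_isTopGenerator hγ hγᵥ n), layerLoc_conjMap]
  rfl

/-- **The localisation `loc_v : 𝐇¹_Γ(T_pW) → 𝐇¹_loc(T_pW|_{Γ_{ℚ_v}})`** (the first arrow of Kato's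
(17.13.1), before the quotient by `𝐇¹_loc(T')`), for the pinned global datum `I` and a pinned local
datum `J`, under: `κ ∘ res_v` onto (`hsurj`; automatic at `v = p` for the cyclotomic `κ`,
`surjective_comp_resGalOfEmb_of_isCyclotomic`) and `γ`, `res γᵥ` normalised topological generators
(`hγ`, `hγᵥ`; such `γᵥ` exist, `ZpExtension.IsCyclotomic.exists_isTopGenerator_resGalOfEmb_adicCompletion`)
— the unique map with `J.proj n (loc x) = loc_n (I.proj n x)` for all `n` (`proj_loc`, `loc_unique`).
It is `Λ`-LINEAR: additive by construction; compatible with polynomials in `X` because `loc_n`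
intertwines the level operators (`layerLoc_comp_conj_sub_one`), and with all of `Λ` because both
actions are levelwise through `Λ/(ω_n)` (`IwasawaH1Data.proj_smul`, `LocalIwasawaH1Data.proj_smul`) —
no topology is used. [cite: Kato2004Asterisque, §17.13 (17.13.1) (p. 279)] -/
def loc (hsurj : Function.Surjective
      (κ.toContinuousMonoidHom.comp (resGalOfEmb (closureEmb (K := ℚ) (v.adicCompletion ℚ)))))
    (hγ : κ.IsTopGenerator γ)
    (hγᵥ : κ.IsTopGenerator (resGalOfEmb (closureEmb (K := ℚ) (v.adicCompletion ℚ)) γᵥ)) :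
    I.H →ₗ[IwasawaAlgebra p] J.H where
  toFun x := (J.proj_surjective _ (I.isLocalNormCompatible_locFamily hsurj x)).choose
  map_add' x x' := J.ext_of_proj fun n ↦ by
    rw [map_add, (J.proj_surjective _ (I.isLocalNormCompatible_locFamily hsurj (x + x'))).choose_spec,
      (J.proj_surjective _ (I.isLocalNormCompatible_locFamily hsurj x)).choose_spec,
      (J.proj_surjective _ (I.isLocalNormCompatible_locFamily hsurj x')).choose_spec,
      locFamily_apply, locFamily_apply, locFamily_apply, map_add, map_add]
  map_smul' f x := J.ext_of_proj fun n ↦ by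
    obtain ⟨r, hr⟩ := IwasawaH1Exists.exists_polynomial_sub_coe_mem_span p n f
    rw [RingHom.id_apply,
      (J.proj_surjective _ (I.isLocalNormCompatible_locFamily hsurj (f • x))).choose_spec,
      J.proj_smul n hr,
      (J.proj_surjective _ (I.isLocalNormCompatible_locFamily hsurj x)).choose_spec,
      locFamily_apply, locFamily_apply, I.proj_smul hγ n hr]
    exact map_aeval_apply_of_comp_eq' (layerLoc (tateRep W p) κ v n).hom.toLinearMap _ _
      (layerLoc_comp_conj_sub_one hγ hγᵥ n) r (I.proj n x)

/-- **The defining property of `loc_v`**: `J.proj n (loc x) = loc_n (I.proj n x)` — the localisation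
is computed levelwise. [cite: Kato2004Asterisque, §17.13 (17.13.1) (p. 279)] -/
theorem proj_loc (hsurj : Function.Surjective
      (κ.toContinuousMonoidHom.comp (resGalOfEmb (closureEmb (K := ℚ) (v.adicCompletion ℚ)))))
    (hγ : κ.IsTopGenerator γ)
    (hγᵥ : κ.IsTopGenerator (resGalOfEmb (closureEmb (K := ℚ) (v.adicCompletion ℚ)) γᵥ))
    (n : ℕ) (x : I.H) :
    J.proj n (I.loc J hsurj hγ hγᵥ x) = layerLoc (tateRep W p) κ v n (I.proj n x) :=
  (J.proj_surjective _ (I.isLocalNormCompatible_locFamily hsurj x)).choose_spec n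

/-- **Uniqueness of `loc_v`**: any map `I.H → J.H` computed levelwise by the `loc_n` IS `loc`
(`J.proj` is jointly injective). [cite: Kato2004Asterisque, §17.13 (17.13.1) (p. 279)] -/
theorem loc_unique (hsurj : Function.Surjective
      (κ.toContinuousMonoidHom.comp (resGalOfEmb (closureEmb (K := ℚ) (v.adicCompletion ℚ)))))
    (hγ : κ.IsTopGenerator γ)
    (hγᵥ : κ.IsTopGenerator (resGalOfEmb (closureEmb (K := ℚ) (v.adicCompletion ℚ)) γᵥ))
    {f : I.H → J.H} (hf : ∀ (n : ℕ) (x : I.H), J.proj n (f x) = layerLoc (tateRep W p) κ v n (I.proj n x)) :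
    f = I.loc J hsurj hγ hγᵥ :=
  funext fun x ↦ J.ext_of_proj fun n ↦ by rw [hf, proj_loc]

/-- `loc_v` of the `Λ`-adic class of a norm-compatible INTEGRAL family `(y_n)_n` (e.g. Kato's zeta
element `(z_{p^n})_n ↦ 𝐳`, `IwasawaH1Data.exists_unique_lift`) is the `Λ`-adic class of the local
family `(loc_n y_n)_n`. [cite: Kato2004Asterisque, §17.13 (17.13.1) (p. 279)] -/
theorem proj_loc_of_proj_eq (hsurj : Function.Surjective
      (κ.toContinuousMonoidHom.comp (resGalOfEmb (closureEmb (K := ℚ) (v.adicCompletion ℚ)))))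
    (hγ : κ.IsTopGenerator γ)
    (hγᵥ : κ.IsTopGenerator (resGalOfEmb (closureEmb (K := ℚ) (v.adicCompletion ℚ)) γᵥ))
    {x : I.H} {y : ∀ n : ℕ, H1 (tateRep W p) (κ.layerSubgroup n)} (hx : ∀ n, I.proj n x = y n) (n : ℕ) :
    J.proj n (I.loc J hsurj hγ hγᵥ x) = layerLoc (tateRep W p) κ v n (y n) := by
  rw [proj_loc, hx]

end IwasawaH1Data

end Loc

/-! ## §5 The ordinary part `F⁺_v T_pE = T_p(E₁(K̄_v)) ≤ T_pE` at a finite place (`T' = T ∩ V'` of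
Kato 17.9 / (17.13.3) for `T = T_pE`, read on the Tate module of the tree) -/

section OrdinaryPart

variable {K : Type} [Field K] [NumberField K] (W : WeierstrassCurve K) (p : ℕ) [Fact p.Prime]
  (v : HeightOneSpectrum (𝓞 K))

/-- **`F⁺_v T_pE := ker (T_p(E) → T_p(Ẽ_v)) = T_p(E₁(K̄_v))`**, the ORDINARY PART of the Tate module at
the finite place `v`: the elements `a = (a_k)_k ∈ T_pE = lim← E[p^k]` all of whose components `a_k`
lie, under the chosen embedding `E(K̄) → E(K̄_v)` (`pointsMapOfEmb W (closureEmb K_v)`), in the kernel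
of reduction `E₁(K̄_v)` (`WeierstrassCurve.localKernelOfReduction v`; the finite levels are the tree's
`WeierstrassCurve.torsionFilAt W v (p^k)`).  A `ℤ_p`-submodule (`E₁` is a subgroup, and
`(c • a)_k = (c mod p^k)·a_k`), stable under the decomposition group `Γ_{K_v}` acting through
`absGaloisRestrict K K_v` (`smul_mem_tateModuleFilAt`).  For `v ∣ p` of good ORDINARY reduction this is
Kato's `T' = T ∩ V'_{F_λ}` for `T = T_pE` (17.2, Lemma 17.9, (17.13.3): "`lim← H¹_f(ℚ_p(ζ_{p^n}),
T(r))(k−r) ≅ 𝐇¹_loc(T'(k))` where `T' = T ∩ V'`"; Greenberg LNM 1716 §2: `F⁺ = 𝓕(𝔪̄)`, the formal group), a rank-one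
direct summand with unramified quotient `T_p(Ẽ_v)` — THEOREMS for other files: nothing about rank,
saturation or the quotient is asserted here (the definition makes sense at every `v`).
[cite: Kato2004Asterisque, Lemma 17.9 (p. 275) and §17.13 (17.13.3) (p. 279)] [cite: GreenbergLNM1716, §2 (pp. 82–83)] -/
def tateModuleFilAt : Submodule ℤ_[p] (W.tateModule p) where
  carrier := {a | ∀ k : ℕ, pointsMapOfEmb W (closureEmb (K := K) (v.adicCompletion K))
    (TateModule.proj p k a : WeierstrassCurve.geomPoints W) ∈ W.localKernelOfReduction v}
  zero_mem' k := by
    rw [map_zero, map_zero]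
    exact zero_mem _
  add_mem' {a b} ha hb k := by
    rw [map_add, map_add]
    exact add_mem (ha k) (hb k)
  smul_mem' c a ha k := by
    rw [TateModule.proj_smul, map_nsmul]
    exact AddSubgroup.nsmul_mem _ (ha k) _

/-- Membership in `F⁺_v T_pE`: every component lies in `E₁(K̄_v)`.
[cite: Kato2004Asterisque, §17.13 (17.13.3) (p. 279)] -/
theorem mem_tateModuleFilAt_iff (a : W.tateModule p) :
    a ∈ tateModuleFilAt W p v ↔ ∀ k : ℕ, pointsMapOfEmb W (closureEmb (K := K) (v.adicCompletion K))
      (TateModule.proj p k a : WeierstrassCurve.geomPoints W) ∈ W.localKernelOfReduction v :=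
  Iff.rfl

/-- Membership in `F⁺_v T_pE` level by level: every component `a_k ∈ E[p^k]` lies in the tree's
finite-level ordinary filtration `Fil_v E[p^k] = E[p^k] ∩ E₁(K̄_v)` (`WeierstrassCurve.torsionFilAt`),
i.e. `F⁺_v T_pE = lim←_k Fil_v E[p^k]`. [cite: Howard2004HeegnerKolyvagin, §3.1 (Fil_v T = ker (T_p(E) → T_p(Ẽ)))] -/
theorem mem_tateModuleFilAt_iff_torsionFilAt (a : W.tateModule p) :
    a ∈ tateModuleFilAt W p v ↔ ∀ k : ℕ,
      (⟨TateModule.proj p k a, W.proj_tateModule_mem_geomTorsion p k a⟩ :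
          WeierstrassCurve.geomTorsion W ((p ^ k : ℕ) : ℤ)) ∈ W.torsionFilAt v ((p ^ k : ℕ) : ℤ) :=
  Iff.rfl

/-- **`F⁺_v T_pE` is stable under the decomposition group `Γ_{K_v}`** (acting on `T_pE` through
`absGaloisRestrict K K_v`, i.e. through the local representation `(T_pE)|_{Γ_{K_v}}`): `E₁(K̄_v)` is
`Γ_{K_v}`-stable and the embedding of points is equivariant.
[cite: GreenbergLNM1716, §2 (pp. 82–83)] [cite: Howard2004HeegnerKolyvagin, §3.1] -/
theorem smul_mem_tateModuleFilAt (σ : absoluteGaloisGroup (v.adicCompletion K)) {a : W.tateModule p}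
    (ha : a ∈ tateModuleFilAt W p v) :
    absGaloisRestrict K (v.adicCompletion K) σ • a ∈ tateModuleFilAt W p v := fun k ↦ by
  rw [TateModule.proj_smul_of_distribMulAction, ← WeierstrassCurve.resGal_eq_absGaloisRestrict,
    resGal_eq, pointsMapOfEmb_smul]
  exact (W.smul_mem_localKernelOfReduction_iff v σ _).2 (ha k)

/-- The same for the local Tate representation of an elliptic curve over `ℚ` in the currency of this
file: `(T_pW)|_{Γ_{ℚ_v}} = (tateRep W p).toLocal v` preserves `F⁺_v T_pW`, so `F⁺_v T_pW` is a
`Γ_{ℚ_v}`-subrepresentation (the `T'` whose local Iwasawa cohomology `𝐇¹_loc(T')` is the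
`H¹_f`-part of `𝐇¹_loc(T)` at good ordinary `p`, Kato (17.13.3)). [cite: Kato2004Asterisque, §17.13 (17.13.3) (p. 279)] -/
theorem tateRep_toLocal_mem_tateModuleFilAt (W : WeierstrassCurve ℚ) [W.IsElliptic] (p : ℕ)
    [Fact p.Prime] [ContinuousSMul ℤ_[p] (W.tateModule p)] (v : HeightOneSpectrum (𝓞 ℚ))
    (σ : absoluteGaloisGroup (v.adicCompletion ℚ)) {a : W.tateModule p}
    (ha : a ∈ tateModuleFilAt W p v) : (tateRep W p).toLocal v σ a ∈ tateModuleFilAt W p v :=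
  smul_mem_tateModuleFilAt W p v σ ha

end OrdinaryPart

end Literature.NumberTheory.EllipticCurves.Kato2004

end
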